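import Summits.CriticalPhenomena.PercolationContinuityZ3.Theorems.FK.SphereArmEvents
import Summits.CriticalPhenomena.PercolationContinuityZ3.Theorems.FK.GibbsThetaSandwich
import Summits.CriticalPhenomena.PercolationContinuityZ3.Theorems.FK.RegionLawMonotone
import Literature.Probability.Percolation.KestenZhangSurface
import Literature.Probability.Percolation.KestenZhangPeierls
import HarnessLib

/-!
# Block arm events under an FK-Gibbs measure: locality, translation, the wired-box bound
# `φ¹_{Λ_L}(𝓦_N) ≤ 2d(2N+1)^{d-1} φ¹_{Λ_{L-N}}(0 ↔ ∂Λ_N)`, and the sparse product bound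
# `P(⋂_{b ∈ T} 𝓦_N((2N+1) b)) ≤ φ¹_{Λ_L}(𝓦_N)^{#T}` (Grimmett 2006, proof of Thm. (5.86), (5.94)–(5.98))

Claimed R42 (8)(c) in the cell INBOX at 2026-08-27T17:08:47Z by fkp-10a gen 350 under provision (ι) (coordinator fk-4 g257 closed 16:26Z 2026-08-27; the lane lead absorbs the registry word; silence = consent), addressed to the lane lead and the next seated coordinator fk-4 (ruling R137); lineage row FO-10a-g350 (self-suggested), package g350-volexp, label VX-B.
Support file of the `fk-continuity` cell (lineage fkp-10a, `--supports stmt-CriticalPhenomena-4575`); builds on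
p205010 (kernel theorem, internal audit signed; external expert review pending).  No definitions, no named facts,
no sorries; standard axioms.  Every `d`, every `FKGibbs d p q P` (`0 ≤ p ≤ 1`, `q ≥ 1`).

Grimmett 2006, §5.6 pp. 121–122, bounds `φ⁰_{p,q}(all vertices of w are white)` for a connected set `w` of `m`
blocks: choose `t ≥ cm` blocks `y(r)` of `w` whose neighbourhoods `N y(r) + Λ_{bN}` are disjoint ((5.94)); "the events
`{y(r) is white}` are dependent under `φ⁰_{p,q}`.  However, by positive association … under the conditional measure
[given all boundary edges of the boxes open] the events … are independent, whence
**(5.96)** `φ⁰_{p,q}(y(r) white, r ≤ t) ≤ {φ¹_{Λ_{bN},p,q}(0 is white)}^t`"; and **(5.98)**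
`τ ≤ Σ_x φ¹_{Λ_{bN}}(x ↔ x + ∂Λ_N) ≤ |R| φ¹_{Λ_{aN},p,q}(0 ↔ ∂Λ_N)` (`φ¹_{Λ_{bN}} ≤st φ¹_{Λ_{aN}}`, translation).
We obtain (5.96) directly from the DOMAIN MARKOV / WIRED DOMINATION sandwich of the tree's `FKGibbs` interface
(Lemma (4.13) + Lemma (4.14)(b): `P(A ∩ H) ≤ φ¹_{Λ,p,q}(A) P(H)` for `A` increasing inside `Λ` and `H` determined
off `E_Λ`, `FKGibbs.le_wired_mul_of_determinedBy_sym2`), by induction over the sparse family — for EVERY measure of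
the class, not only `φ⁰_{p,q}` — with the white events of `BlockArmGeometry.lean`,
`𝓦_N(c) = {ω | ∃ z ∈ ∂Λ_N, ω ∈ armEvent (z + c) N}` (some boundary site of the block with centre `c` has an open
arm of length `N`), which are increasing and determined by the pairs of `c + Λ_{2N}`:

* `measureReal_biInter_le_pow_of_forall_inter_le` — THE PRODUCT UPPER BOUND (measure-generic, dual to the row's
  `measureReal_biInter_compl_le_pow`): events `W i` determined by finite pair sets `S i`, "exclusion sets" `R i` with
  `S j ∩ R i = ∅` (`i ≠ j`), and `μ(W i ∩ H) ≤ τ μ(H)` for every measurable `H` determined off `R i`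
  `⟹ μ(⋂_{i ∈ I} W i) ≤ τ^{#I} μ(univ)`;
* `isUpperSet_blockArm`, `measurableSet_blockArm`, `determinedBy_blockArm` (by the pairs of `c + Λ_{2N}`),
  `preimage_relabel_shift_armEvent` (`τ_v ⁻¹' armEvent z N = armEvent (z + v) N`), `preimage_relabel_shift_blockArm`,
  `regionWiredReal_map_shift_blockArm` (translation covariance of the wired box law of `𝓦`);
* **`regionWiredReal_blockArm_le`** — (5.98): `φ¹_{Λ_L,p,q}(𝓦_N(0)) ≤ 2d(2N+1)^{d-1} φ¹_{Λ_{L-N},p,q}(0 ↔ ∂Λ_N)` for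
  `2N ≤ L` (union bound over `∂Λ_N`; `φ¹_{Λ_L} ≤ φ¹_{z + Λ_{L-N}}` on increasing events inside `z + Λ_{L-N} ⊆ Λ_L`,
  the tree's `regionWiredReal_anti`; translation `regionWiredReal_shift`);
* `disjoint_sym2_edgesIn_of_sparse` (the neighbourhoods of `r`-sparse blocks: `(2N+1)b' + Λ_{2N}` carries no edge of
  `(2N+1)b + Λ_L` when `L ≤ (2N+1) r < (2N+1) ‖b - b'‖_∞`);
* **`FKGibbs.real_biInter_blockArm_le_pow`** — (5.96) for the class: for `FKGibbs d p q P`, `2N ≤ L ≤ (2N+1) r` and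
  every finite `T ⊆ ℤ^d` with pairwise sup-distances `> r`:
  `P(⋂_{b ∈ T} 𝓦_N((2N+1) b)) ≤ φ¹_{Λ_L,p,q}(𝓦_N(0))^{#T}`; `FKGibbs.real_biInter_blockArm_le_pow_mul` (the `δ`-form
  `≤ δ^{(r+1)^d #T}` consumed by the tree's Peierls estimate `measureReal_exists_starAnimal_bad_le`).

## References

* G. Grimmett, *The Random-Cluster Model*, Springer 2006: §5.6, proof of Thm. (5.86), (5.94)–(5.98) pp. 121–122;
  Lemma (4.13), Lemma (4.14)(b), §4.3 (translations). [Grimmett2006]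
* H. Kesten, J. Statist. Phys. 25 (1981) 717–756, §2 (Grimmett's [209]). [Kesten1981Analyticity]
-/

noncomputable section

open scoped Classical
open MeasureTheory Finset Filter

namespace Summit.CriticalPhenomena.PercolationContinuityZ3.Theorems

namespace FK

open Literature.Probability.LatticeModels Literature.Probability.Percolation
  Literature.Probability.Percolation.DCT16

variable {d : ℕ}

/-! ### The product upper bound for events with a conditional ceiling -/

/-- **The product upper bound.** Let `μ` be a finite measure on bond configurations, `I` a finite index set, `W i`
measurable events determined by finite pair sets `S i`, and `R i` finite "exclusion" sets with `S j` disjoint from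
`R i` for `i ≠ j`; if `μ(W i ∩ H) ≤ τ μ(H)` (`τ ≥ 0`) for every `i ∈ I` and every measurable `H` determined by a finite
pair set disjoint from `R i`, then `μ(⋂_{i ∈ I} W i) ≤ τ^{#I} μ(univ)` (induction on `I`: the intersection over the
other indices is determined by the union of their `S j`, which is disjoint from `R i`).
[cite: Grimmett2006, §5.6 proof of Thm. (5.86), (5.95)–(5.96) p. 122] -/
theorem measureReal_biInter_le_pow_of_forall_inter_le {V ι : Type*} [DecidableEq ι] [DecidableEq V]
    (μ : Measure (BondConfig V)) [IsFiniteMeasure μ] {I : Finset ι} {S R : ι → Finset (Sym2 V)}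
    {W : ι → Set (BondConfig V)} {τ : ℝ} (hτ : 0 ≤ τ)
    (hdisj : ∀ i ∈ I, ∀ j ∈ I, i ≠ j → Disjoint (S j) (R i))
    (hWdet : ∀ i ∈ I, DeterminedBy (W i) ↑(S i)) (hWm : ∀ i ∈ I, MeasurableSet (W i))
    (hle : ∀ i ∈ I, ∀ (H : Set (BondConfig V)) (T : Finset (Sym2 V)), MeasurableSet H → DeterminedBy H ↑T →
      Disjoint T (R i) → μ.real (W i ∩ H) ≤ τ * μ.real H) :
    μ.real (⋂ i ∈ I, W i) ≤ τ ^ I.card * μ.real Set.univ := by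
  induction I using Finset.induction_on with
  | empty => simp
  | @insert a I haI ih =>
    have ih' := ih (fun i hi j hj hne => hdisj i (Finset.mem_insert_of_mem hi) j (Finset.mem_insert_of_mem hj) hne)
      (fun i hi => hWdet i (Finset.mem_insert_of_mem hi)) (fun i hi => hWm i (Finset.mem_insert_of_mem hi))
      (fun i hi => hle i (Finset.mem_insert_of_mem hi))
    set H : Set (BondConfig V) := ⋂ i ∈ I, W i with hH
    have hHm : MeasurableSet H :=
      MeasurableSet.biInter I.countable_toSet fun i hi => hWm i (Finset.mem_insert_of_mem hi)
    have hHdet : DeterminedBy H ↑(I.biUnion S) := by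
      refine DeterminedBy.iInter fun i => DeterminedBy.iInter fun hi => ?_
      refine (hWdet i (Finset.mem_insert_of_mem hi)).mono fun e he => ?_
      exact Finset.mem_coe.2 (Finset.mem_biUnion.2 ⟨i, hi, he⟩)
    have hTdisj : Disjoint (I.biUnion S) (R a) := by
      rw [Finset.disjoint_biUnion_left]
      intro i hi
      exact hdisj a (Finset.mem_insert_self a I) i (Finset.mem_insert_of_mem hi) (fun h => haI (h ▸ hi))
    have hstep : μ.real (W a ∩ H) ≤ τ * μ.real H :=
      hle a (Finset.mem_insert_self a I) H (I.biUnion S) hHm hHdet hTdisj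
    have hset : (⋂ i ∈ insert a I, W i) = W a ∩ H := by
      ext ω; simp [hH]
    rw [hset, Finset.card_insert_of_notMem haI, pow_succ]
    calc μ.real (W a ∩ H) ≤ τ * μ.real H := hstep
      _ ≤ τ * (τ ^ I.card * μ.real Set.univ) := mul_le_mul_of_nonneg_left ih' hτ
      _ = τ ^ I.card * τ * μ.real Set.univ := by ring

/-! ### The block arm event: monotone, measurable, local, translation covariant -/

/-- The translated one-arm event `armEvent v N` is increasing. [folklore] -/
theorem isUpperSet_armEvent' (v : Site d) (N : ℕ) : IsUpperSet (armEvent v N) := by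
  rw [← preimage_shift_siteToBoundary v N]
  exact (isUpperSet_siteToBoundary d N).preimage_relabel _

/-- `𝓦_N(c)` is increasing. [cite: Grimmett2006, §5.6 p. 119 (the event {x is white} is increasing)] -/
theorem isUpperSet_blockArm (c : Site d) (N : ℕ) :
    IsUpperSet {ω : BondConfig (Site d) | ∃ z ∈ innerBoundary (zdGraph d) (box d N), ω ∈ armEvent (z + c) N} := by
  intro ω ω' hle hω
  obtain ⟨z, hz, hωz⟩ := hω
  exact ⟨z, hz, isUpperSet_armEvent' (z + c) N hle hωz⟩

/-- `𝓦_N(c)` is measurable. [folklore] -/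
theorem measurableSet_blockArm (c : Site d) (N : ℕ) :
    MeasurableSet {ω : BondConfig (Site d) | ∃ z ∈ innerBoundary (zdGraph d) (box d N), ω ∈ armEvent (z + c) N} := by
  have h : {ω : BondConfig (Site d) | ∃ z ∈ innerBoundary (zdGraph d) (box d N), ω ∈ armEvent (z + c) N} =
      ⋃ z ∈ innerBoundary (zdGraph d) (box d N), armEvent (z + c) N := by
    ext ω; simp only [Set.mem_setOf_eq, Set.mem_iUnion, exists_prop]
  rw [h]
  exact MeasurableSet.biUnion (Finset.countable_toSet _) fun z _ => measurableSet_zdArmEvent (z + c) N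

/-- The translated one-arm event `armEvent v R` is determined by the pairs of the finite box `v + Λ_R` (Finset form of
the tree's `determinedBy_zdArmEvent`). [folklore] -/
theorem determinedBy_armEvent_map_shift (v : Site d) (R : ℕ) :
    DeterminedBy (armEvent v R) (↑(((box d R).map (Site.shift v).toEmbedding).sym2) : Set (Sym2 (Site d))) := by
  have h := determinedBy_zdArmEvent v R
  rw [setOf_sub_mem_box_eq v R, ← Finset.coe_sym2] at h
  refine h.mono (Finset.coe_subset.2 (Finset.sym2_mono fun w hw => ?_))
  rw [Finset.mem_image] at hw
  obtain ⟨y, hy, rfl⟩ := hw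
  rw [Finset.mem_map_equiv, Site.shift_symm_apply, add_sub_cancel_right]
  exact hy

/-- The box `(z + c) + Λ_N`, `‖z‖ = N`, lies in `c + Λ_{2N}`. [folklore] -/
theorem map_shift_add_box_subset {z : Site d} {N : ℕ} (hz : z ∈ innerBoundary (zdGraph d) (box d N))
    (c : Site d) :
    (box d N).map (Site.shift (z + c)).toEmbedding ⊆ (box d (2 * N)).map (Site.shift c).toEmbedding := by
  intro w hw
  rw [Finset.mem_map_equiv, Site.shift_symm_apply, mem_box_iff_siteRad_le] at hw ⊢
  have h1 := siteRad_add_le (w - (z + c)) z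
  rw [show w - (z + c) + z = w - c by abel, siteRad_eq_of_mem_innerBoundary_box hz] at h1
  omega

/-- **`𝓦_N(c)` is determined by the pairs of `c + Λ_{2N}`.** [cite: Grimmett2006, §5.6 p. 119 (defined in terms of the edges of Δ(x))] -/
theorem determinedBy_blockArm (c : Site d) (N : ℕ) :
    DeterminedBy {ω : BondConfig (Site d) | ∃ z ∈ innerBoundary (zdGraph d) (box d N), ω ∈ armEvent (z + c) N}
      (↑(((box d (2 * N)).map (Site.shift c).toEmbedding).sym2) : Set (Sym2 (Site d))) := by
  have h : {ω : BondConfig (Site d) | ∃ z ∈ innerBoundary (zdGraph d) (box d N), ω ∈ armEvent (z + c) N} =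
      ⋃ z ∈ innerBoundary (zdGraph d) (box d N), armEvent (z + c) N := by
    ext ω; simp only [Set.mem_setOf_eq, Set.mem_iUnion, exists_prop]
  rw [h]
  exact DeterminedBy.iUnion fun z => DeterminedBy.iUnion fun hz =>
    (determinedBy_armEvent_map_shift (z + c) N).mono
      (Finset.coe_subset.2 (Finset.sym2_mono (map_shift_add_box_subset hz c)))

/-- **Translation of arm events**: `τ_v ⁻¹' armEvent z N = armEvent (z + v) N`, where `τ_v ω = ω - v` is the
relabelling by `Site.shift (-v)`. [cite: Grimmett2006, §4.3 (translations τ_x)] -/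
theorem preimage_relabel_shift_armEvent (v z : Site d) (N : ℕ) :
    BondConfig.relabel (sym2Equiv (Site.shift (-v))) ⁻¹' armEvent z N = armEvent (z + v) N := by
  ext ω
  rw [Set.mem_preimage, ← preimage_shift_siteToBoundary z N, ← preimage_shift_siteToBoundary (z + v) N,
    Set.mem_preimage, Set.mem_preimage]
  have hsymm : (⇑(Site.shift (-(z + v))).symm : Site d → Site d) =
      ⇑(Site.shift (-v)).symm ∘ ⇑(Site.shift (-z)).symm := by
    funext x
    simp only [Site.shift_symm_apply, Function.comp_apply]
    abel
  have hcfg : BondConfig.relabel (sym2Equiv (Site.shift (-z))) (BondConfig.relabel (sym2Equiv (Site.shift (-v))) ω) =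
      BondConfig.relabel (sym2Equiv (Site.shift (-(z + v)))) ω := by
    ext e
    simp only [BondConfig.mem_relabel_iff, sym2Equiv_symm, sym2Equiv_apply, Sym2.map_map, hsymm]
  rw [hcfg]

/-- **Translation of the block arm event**: `τ_v ⁻¹' 𝓦_N(c) = 𝓦_N(c + v)`. [cite: Grimmett2006, §4.3 (translations τ_x)] -/
theorem preimage_relabel_shift_blockArm (v c : Site d) (N : ℕ) :
    BondConfig.relabel (sym2Equiv (Site.shift (-v))) ⁻¹'
        {ω : BondConfig (Site d) | ∃ z ∈ innerBoundary (zdGraph d) (box d N), ω ∈ armEvent (z + c) N} =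
      {ω : BondConfig (Site d) | ∃ z ∈ innerBoundary (zdGraph d) (box d N), ω ∈ armEvent (z + (c + v)) N} := by
  ext ω
  simp only [Set.mem_preimage, Set.mem_setOf_eq]
  refine exists_congr fun z => and_congr_right fun _ => ?_
  rw [← Set.mem_preimage, preimage_relabel_shift_armEvent, add_assoc]

/-- `(Λ + c) - c = Λ`. [folklore] -/
theorem map_shift_map_shift_neg (Λ : Finset (Site d)) (c : Site d) :
    (Λ.map (Site.shift c).toEmbedding).map (Site.shift (-c)).toEmbedding = Λ := by
  ext x
  simp only [Finset.mem_map_equiv, Site.shift_symm_apply, sub_neg_eq_add]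
  rw [show x + c - c = x by abel]

/-- **Translation covariance of the wired box law of the block arm event**:
`φ¹_{c + Λ_L,p,q}(𝓦_N(c)) = φ¹_{Λ_L,p,q}(𝓦_N(0))`. [cite: Grimmett2006, §4.3 (translations τ_x); (5.96) 'by symmetry'] -/
theorem regionWiredReal_map_shift_blockArm {p q : ℝ} (hp : p ∈ Set.Icc (0 : ℝ) 1) (hq : 0 < q) (c : Site d)
    (N L : ℕ) :
    regionWiredReal d p q ((box d L).map (Site.shift c).toEmbedding)
        {ω : BondConfig (Site d) | ∃ z ∈ innerBoundary (zdGraph d) (box d N), ω ∈ armEvent (z + c) N} =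
      regionWiredReal d p q (box d L)
        {ω : BondConfig (Site d) | ∃ z ∈ innerBoundary (zdGraph d) (box d N), ω ∈ armEvent z N} := by
  have h : BondConfig.relabel (sym2Equiv (Site.shift (-c))) ⁻¹'
        {ω : BondConfig (Site d) | ∃ z ∈ innerBoundary (zdGraph d) (box d N), ω ∈ armEvent z N} =
      {ω : BondConfig (Site d) | ∃ z ∈ innerBoundary (zdGraph d) (box d N), ω ∈ armEvent (z + c) N} := by
    ext ω
    simp only [Set.mem_preimage, Set.mem_setOf_eq]
    refine exists_congr fun z => and_congr_right fun _ => ?_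
    rw [← Set.mem_preimage, preimage_relabel_shift_armEvent]
  rw [← h, regionWiredReal_shift (-c) hp hq, map_shift_map_shift_neg]

/-! ### (5.98): the wired box law of the block arm event -/

/-- `z + Λ_M ⊆ Λ_L` when `‖z‖ + M ≤ L`. [folklore] -/
theorem map_shift_box_subset_box {z : Site d} {M L : ℕ} (h : siteRad z + M ≤ L) :
    (box d M).map (Site.shift z).toEmbedding ⊆ box d L := by
  intro y hy
  rw [Finset.mem_map_equiv, Site.shift_symm_apply, mem_box_iff_siteRad_le] at hy
  rw [mem_box_iff_siteRad_le]
  have h1 := siteRad_add_le (y - z) z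
  rw [sub_add_cancel] at h1
  omega

/-- One arm from a sphere site, under the wired law of `Λ_L`: for `‖z‖ = N` and `2N ≤ L`,
`φ¹_{Λ_L,p,q}(armEvent z N) ≤ φ¹_{Λ_{L-N},p,q}(0 ↔ ∂Λ_N)` (`φ¹_{Λ_L} ≤ φ¹_{z + Λ_{L-N}}` on increasing events
inside `z + Λ_{L-N} ⊆ Λ_L`, then translation). [cite: Grimmett2006, §5.6 proof of Thm. (5.86), (5.98) p. 122] -/
theorem regionWiredReal_armEvent_le {p q : ℝ} (hp : p ∈ Set.Icc (0 : ℝ) 1) (hq : 1 ≤ q) {N L : ℕ} (hL : 2 * N ≤ L)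
    {z : Site d} (hz : z ∈ innerBoundary (zdGraph d) (box d N)) :
    regionWiredReal d p q (box d L) (armEvent z N) ≤ regionWiredReal d p q (box d (L - N)) (siteToBoundary d N) := by
  have hq0 : 0 < q := one_pos.trans_le hq
  have hzN : siteRad z = N := siteRad_eq_of_mem_innerBoundary_box hz
  -- the lattice reading of the arm event is increasing and determined by `E_{z + Λ_N} ⊆ E_{z + Λ_{L-N}}`
  set A : Set (BondConfig (Site d)) := (fun ω => ω ∩ (zdGraph d).edgeSet) ⁻¹' armEvent z N with hA
  have hAup : IsUpperSet A := isUpperSet_preimage_inter_edgeSet (isUpperSet_armEvent' z N)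
  have hsub : (box d N).map (Site.shift z).toEmbedding ⊆ (box d (L - N)).map (Site.shift z).toEmbedding :=
    Finset.map_subset_map.2 (box_mono d (by omega))
  have hAdet : DeterminedBy A ↑(edgesIn (zdGraph d) ((box d (L - N)).map (Site.shift z).toEmbedding)) := by
    refine (determinedBy_preimage_inter_edgeSet (determinedBy_armEvent_map_shift z N)).mono fun e he => ?_
    rw [Finset.mem_coe, mem_edgesIn_iff] at he ⊢
    exact ⟨he.1, fun x hx => hsub (he.2 x hx)⟩
  have hΛ : (box d (L - N)).map (Site.shift z).toEmbedding ⊆ box d L :=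
    map_shift_box_subset_box (by rw [hzN]; omega)
  calc regionWiredReal d p q (box d L) (armEvent z N)
      = regionWiredReal d p q (box d L) A := (regionWiredReal_preimage_inter_edgeSet hp hq0 _ _).symm
    _ ≤ regionWiredReal d p q ((box d (L - N)).map (Site.shift z).toEmbedding) A :=
        regionWiredReal_anti hp hq hΛ hAup hAdet
    _ = regionWiredReal d p q ((box d (L - N)).map (Site.shift z).toEmbedding) (armEvent z N) :=
        regionWiredReal_preimage_inter_edgeSet hp hq0 _ _
    _ = regionWiredReal d p q (box d (L - N)) (siteToBoundary d N) := by
        rw [← preimage_shift_siteToBoundary z N, regionWiredReal_shift (-z) hp hq0, map_shift_map_shift_neg]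

/-- **Grimmett 2006 (5.98) for the block arm event**: for `0 ≤ p ≤ 1`, `q ≥ 1`, `2N ≤ L`,
`φ¹_{Λ_L,p,q}(𝓦_N(0)) ≤ |∂Λ_N| · φ¹_{Λ_{L-N},p,q}(0 ↔ ∂Λ_N) ≤ 2d(2N+1)^{d-1} · φ¹_{Λ_{L-N},p,q}(0 ↔ ∂Λ_N)`.
[cite: Grimmett2006, §5.6 proof of Thm. (5.86), (5.98) p. 122] -/
theorem regionWiredReal_blockArm_le {p q : ℝ} (hp : p ∈ Set.Icc (0 : ℝ) 1) (hq : 1 ≤ q) {N L : ℕ} (hL : 2 * N ≤ L) :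
    regionWiredReal d p q (box d L)
        {ω : BondConfig (Site d) | ∃ z ∈ innerBoundary (zdGraph d) (box d N), ω ∈ armEvent z N} ≤
      2 * d * (2 * N + 1) ^ (d - 1) * regionWiredReal d p q (box d (L - N)) (siteToBoundary d N) := by
  have hq0 : 0 < q := one_pos.trans_le hq
  haveI := isProbabilityMeasure_rcMeasure (finsetGraph (zdGraph d) (box d L)) hp hq0
    (wiredBoundary (zdGraph d) (box d L))
  have h : {ω : BondConfig (Site d) | ∃ z ∈ innerBoundary (zdGraph d) (box d N), ω ∈ armEvent z N} =
      ⋃ z ∈ innerBoundary (zdGraph d) (box d N), armEvent z N := by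
    ext ω; simp only [Set.mem_setOf_eq, Set.mem_iUnion, exists_prop]
  rw [h, regionWiredReal, Set.preimage_iUnion₂]
  calc (rcMeasure (finsetGraph (zdGraph d) (box d L)) p q (wiredBoundary (zdGraph d) (box d L))).real
        (⋃ z ∈ innerBoundary (zdGraph d) (box d N), liftEdges (box d L) ⁻¹' armEvent z N)
      ≤ ∑ z ∈ innerBoundary (zdGraph d) (box d N),
          (rcMeasure (finsetGraph (zdGraph d) (box d L)) p q (wiredBoundary (zdGraph d) (box d L))).real
            (liftEdges (box d L) ⁻¹' armEvent z N) := measureReal_biUnion_finset_le _ _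
    _ ≤ ∑ _z ∈ innerBoundary (zdGraph d) (box d N), regionWiredReal d p q (box d (L - N)) (siteToBoundary d N) :=
        Finset.sum_le_sum fun z hz => regionWiredReal_armEvent_le hp hq hL hz
    _ = (innerBoundary (zdGraph d) (box d N)).card * regionWiredReal d p q (box d (L - N)) (siteToBoundary d N) := by
        rw [Finset.sum_const, nsmul_eq_mul]
    _ ≤ 2 * d * (2 * N + 1) ^ (d - 1) * regionWiredReal d p q (box d (L - N)) (siteToBoundary d N) := by
        refine mul_le_mul_of_nonneg_right ?_ (by rw [regionWiredReal]; exact measureReal_nonneg)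
        exact_mod_cast card_innerBoundary_box_le N

/-! ### (5.96): the sparse product bound under an FK-Gibbs measure -/

/-- **Sparse blocks have disjoint neighbourhoods**: if `L ≤ (2N+1) r` and `r < ‖b - b'‖_∞` then no pair of sites of
`(2N+1) b' + Λ_{2N}` is a lattice edge inside `(2N+1) b + Λ_L`. [cite: Grimmett2006, §5.6 proof of Thm. (5.86), (5.94) p. 121 (disjoint boxes N y(r) + Λ_{bN})] -/
theorem disjoint_sym2_edgesIn_of_sparse {N L r : ℕ} (hLr : L ≤ (2 * N + 1) * r) {b b' : Site d}
    (hbb' : r < supDist b b') :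
    Disjoint (((box d (2 * N)).map (Site.shift (KestenZhang.ctr N b')).toEmbedding).sym2)
      (edgesIn (zdGraph d) ((box d L).map (Site.shift (KestenZhang.ctr N b)).toEmbedding)) := by
  rw [Finset.disjoint_left]
  intro e he heL
  rw [Finset.mem_sym2_iff] at he
  rw [mem_edgesIn_iff] at heL
  induction e using Sym2.ind with
  | h x y =>
    have hx1 : x ∈ (box d (2 * N)).map (Site.shift (KestenZhang.ctr N b')).toEmbedding := he x (Sym2.mem_mk_left x y)
    have hx2 : x ∈ (box d L).map (Site.shift (KestenZhang.ctr N b)).toEmbedding := heL.2 x (Sym2.mem_mk_left x y)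
    rw [Finset.mem_map_equiv, Site.shift_symm_apply, mem_box] at hx1 hx2
    -- every coordinate of `b - b'` is at most `r` in absolute value
    have hcoord : ∀ i, (b i - b' i).natAbs ≤ r := by
      intro i
      have h1 := hx1 i
      have h2 := hx2 i
      simp only [Pi.sub_apply, KestenZhang.ctr_apply] at h1 h2
      push_cast at h1 h2
      -- `(2N+1)|b i - b' i| ≤ L + 2N ≤ (2N+1) r + 2N < (2N+1)(r+1)`
      have hM : (0 : ℤ) < 2 * N + 1 := by positivity
      have hlt : (2 * N + 1 : ℤ) * |b i - b' i| < (2 * N + 1 : ℤ) * (r + 1) := by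
        have habs : (2 * N + 1 : ℤ) * |b i - b' i| ≤ L + 2 * N := by
          rw [← abs_of_pos hM, ← abs_mul, mul_sub]
          rw [abs_le]
          constructor <;> linarith [h1.1, h1.2, h2.1, h2.2]
        have hLr' : (L : ℤ) ≤ (2 * N + 1) * r := by exact_mod_cast hLr
        linarith
      have := lt_of_mul_lt_mul_left hlt hM.le
      rw [Int.abs_eq_natAbs] at this
      omega
    exact absurd (supDist_le_iff.2 hcoord) (not_le.2 hbb')

variable {p q : ℝ} {P : Measure (BondConfig (Site d))}

/-- **Grimmett 2006 (5.96), for every measure of the sandwich class.** Let `FKGibbs d p q P` (`0 ≤ p ≤ 1`, `q ≥ 1`),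
`2N ≤ L ≤ (2N+1) r`, and let `T ⊆ ℤ^d` be finite with pairwise sup-distances `> r`.  Then
`P(⋂_{b ∈ T} 𝓦_N((2N+1) b)) ≤ φ¹_{Λ_L,p,q}(𝓦_N(0))^{#T}`: conditionally on everything outside `(2N+1) b + Λ_L`
(which carries the other blocks' events), the block arm event of `b` has probability at most its wired box law
(domain Markov + `φ^ξ_Λ ≤st φ¹_Λ`), and the wired box laws of the blocks agree by translation.
[cite: Grimmett2006, §5.6 proof of Thm. (5.86), (5.95)–(5.96) p. 122; Lemma (4.13), Lemma (4.14)(b)] -/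
theorem FKGibbs.real_biInter_blockArm_le_pow (hP : FKGibbs d p q P) (hp : p ∈ Set.Icc (0 : ℝ) 1) (hq : 1 ≤ q)
    {N L r : ℕ} (hNL : 2 * N ≤ L) (hLr : L ≤ (2 * N + 1) * r) (T : Finset (Site d))
    (hT : ∀ x ∈ T, ∀ y ∈ T, x ≠ y → r < supDist x y) :
    P.real (⋂ b ∈ T, {ω : BondConfig (Site d) | ∃ z ∈ innerBoundary (zdGraph d) (box d N),
        ω ∈ armEvent (z + KestenZhang.ctr N b) N}) ≤
      (regionWiredReal d p q (box d L)
        {ω : BondConfig (Site d) | ∃ z ∈ innerBoundary (zdGraph d) (box d N), ω ∈ armEvent z N}) ^ T.card := by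
  haveI := hP.isProbabilityMeasure
  have hq0 : 0 < q := one_pos.trans_le hq
  set τ : ℝ := regionWiredReal d p q (box d L)
    {ω : BondConfig (Site d) | ∃ z ∈ innerBoundary (zdGraph d) (box d N), ω ∈ armEvent z N} with hτ
  have hτ0 : 0 ≤ τ := by rw [hτ, regionWiredReal]; exact measureReal_nonneg
  have h := measureReal_biInter_le_pow_of_forall_inter_le P (I := T) (τ := τ)
    (S := fun b => ((box d (2 * N)).map (Site.shift (KestenZhang.ctr N b)).toEmbedding).sym2)
    (R := fun b => edgesIn (zdGraph d) ((box d L).map (Site.shift (KestenZhang.ctr N b)).toEmbedding))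
    (W := fun b => {ω : BondConfig (Site d) | ∃ z ∈ innerBoundary (zdGraph d) (box d N),
        ω ∈ armEvent (z + KestenZhang.ctr N b) N})
    hτ0
    (fun b hb b' hb' hne => disjoint_sym2_edgesIn_of_sparse hLr (hT b hb b' hb' hne))
    (fun b _ => determinedBy_blockArm _ N) (fun b _ => measurableSet_blockArm _ N)
    (fun b _ H T' _ hH hT' => by
      have hdet : DeterminedBy {ω : BondConfig (Site d) | ∃ z ∈ innerBoundary (zdGraph d) (box d N),
          ω ∈ armEvent (z + KestenZhang.ctr N b) N}
          ↑(((box d L).map (Site.shift (KestenZhang.ctr N b)).toEmbedding).sym2) := by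
        exact (determinedBy_blockArm (KestenZhang.ctr N b) N).mono
          (Finset.coe_subset.2 (Finset.sym2_mono (Finset.map_subset_map.2 (box_mono d hNL))))
      have h2 := hP.le_wired_mul_of_determinedBy_sym2 hp hq0 _ T' (isUpperSet_blockArm _ N) hdet
        (Finset.disjoint_coe.2 hT') hH
      rwa [regionWiredReal_map_shift_blockArm hp hq0] at h2)
  rwa [probReal_univ, mul_one] at h

/-- **The `δ`-form of (5.96)**, as consumed by the tree's Peierls estimate `measureReal_exists_starAnimal_bad_le`: if
`φ¹_{Λ_L,p,q}(𝓦_N(0)) ≤ δ^{(r+1)^d}`, then `P(⋂_{b ∈ T} 𝓦_N((2N+1) b)) ≤ δ^{(r+1)^d #T}` for every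
finite `T` with pairwise sup-distances `> r`. [cite: Grimmett2006, §5.6 proof of Thm. (5.86), (5.96)–(5.97) p. 122] -/
theorem FKGibbs.real_biInter_blockArm_le_pow_mul (hP : FKGibbs d p q P) (hp : p ∈ Set.Icc (0 : ℝ) 1) (hq : 1 ≤ q)
    {N L r : ℕ} (hNL : 2 * N ≤ L) (hLr : L ≤ (2 * N + 1) * r) {δ : ℝ}
    (hsmall : regionWiredReal d p q (box d L)
        {ω : BondConfig (Site d) | ∃ z ∈ innerBoundary (zdGraph d) (box d N), ω ∈ armEvent z N} ≤
      δ ^ (r + 1) ^ d)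
    (T : Finset (Site d)) (hT : ∀ x ∈ T, ∀ y ∈ T, x ≠ y → r < supDist x y) :
    P.real (⋂ b ∈ T, {ω : BondConfig (Site d) | ∃ z ∈ innerBoundary (zdGraph d) (box d N),
        ω ∈ armEvent (z + KestenZhang.ctr N b) N}) ≤ δ ^ ((r + 1) ^ d * T.card) := by
  have hq0 : 0 < q := one_pos.trans_le hq
  refine (hP.real_biInter_blockArm_le_pow hp hq hNL hLr T hT).trans ?_
  rw [pow_mul]
  exact pow_le_pow_left₀ (by rw [regionWiredReal]; exact measureReal_nonneg) hsmall _

end FK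

end Summit.CriticalPhenomena.PercolationContinuityZ3.Theorems

end
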